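import Summits.ValiantsHypothesis.ValiantsHypothesis.Theses.DecompCycle1C
import Literature.Computability.AlgebraicComplexity.DDS21BloatedRatioDeborder
import Literature.Computability.AlgebraicComplexity.DeterminantBorderWaringRank
import Literature.Computability.AlgebraicComplexity.RankMethodBarriersWaring
import HarnessLib

/-!
# Border `Σ^[2]ΠΣ` is universal (Kumar 2020) — tightness of item 23622 in its `IsPBounded d` conjunct

CALIBRATION / TIGHTNESS of the PROVED aside 23622 (PerNotInBorderConstFaninEps, p780459) + Kumar 2020
universality of border Σ^[2]ΠΣ kernelised inline; NOT a decomposition node, NOT a rung, no dial, no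
residual, 0 S-currency; closes no item; the incompleteness of EXACT Σ^[2]ΠΣ (Shpilka–Wigderson 2001) is
NOT claimed here; VP ≠ VNP untouched.

Mathematics (Kumar 2020 ToCT; stated as Prop. 38 "(Kumar)" of Dutta–Gesmundo–Ikenmeyer–Jindal–Lysikov,
JSC 2025, arXiv:2211.07055 p. 17), in the DDS ε-currency of the tree (`DDS2021.border`,
`DDS2021.spsClass`, `MS2021.IsSPS`, `MS2021.IsEpsApprox` via `DDS2021.isEpsApprox_iff_exists_map`):
if `f = ∑_{i<s} A_i^d` with affine forms `A_i` over an algebraically closed field `F`, `d ≥ 1`, and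
`Y^d + 1 = ∏_{k<d} (Y - η_k)` in `F[Y]`, then over `F(ε)`
`P := ∏_{i<s} ∏_{k<d} (ε·A_i - η_k) = ∏_{i<s} (1 + ε^d A_i^d) = 1 + ε^d·g`, where `g` has
`F[ε]`-coefficients with constant term `f`, and `g = P·ε^{-d} + 1·(-ε^{-d}) ∈ Σ^[2]Π^[s·d+1]Σ` (the
scalars `±ε^{-d}` occupy the extra product slot): `f ∈ border (spsClass (RatFunc F) n 2 (s·d+1))`.
With the affine Waring span `mem_span_affinePowers` (char 0) every polynomial is such an `f`, so every
polynomial lies in `border Σ^[k]Π^[D]Σ` for every `k ≥ 2` and some `D`; in particular the permanent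
family does, with a NON-p-bounded `D = d(n)`: item 23622 with its conjunct `IsPBounded d` deleted is false.
The hypotheses `[IsAlgClosed F] [CharZero F]` of the general statements are inhabited by `ℂ` (used in
`perPoly_mem_border_spsClass`); no interface, no new definition, no Literature fact is introduced.
-/

set_option linter.dupNamespace false

noncomputable section

namespace Summit.ValiantsHypothesis.ValiantsHypothesis.Theorems.DecompCycle1CPerBorderTopFaninTwo

open MvPolynomial
open Literature.Computability.AlgebraicComplexity
open Summit.ValiantsHypothesis.ValiantsHypothesis.Theses.DecompCycle1C

/-! ## Private algebraic helpers (affine forms and the closure of `ΠΣ` / `Σ^[2]ΠΣ`) -/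

/-- Base change of an affine form `C c + ∑ C (a m) X_m` along a ring map. -/
private theorem map_affine {R S : Type*} [CommSemiring R] [CommSemiring S] (ψ : R →+* S) {n : ℕ}
    (c : R) (a : Fin n → R) :
    map ψ (C c + ∑ m, C (a m) * X m) = (C (ψ c) + ∑ m, C (ψ (a m)) * X m : MvPolynomial (Fin n) S) := by
  rw [map_add, map_C, map_sum]
  refine congrArg _ (Finset.sum_congr rfl fun m _ => ?_)
  rw [map_mul, map_C, map_X]

/-- A scalar times an affine form is an affine form. -/
private theorem C_mul_affine_eq {K : Type*} [CommSemiring K] {n : ℕ} (e c : K) (a : Fin n → K) :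
    C e * (C c + ∑ m, C (a m) * X m) = (C (e * c) + ∑ m, C (e * a m) * X m : MvPolynomial (Fin n) K) := by
  rw [mul_add, ← C_mul, Finset.mul_sum]
  refine congrArg _ (Finset.sum_congr rfl fun m _ => ?_)
  rw [← mul_assoc, ← C_mul]

/-- `e·(affine form) - t` is a `ΠΣ` circuit with one affine factor. -/
private theorem C_mul_affine_sub_mem {K : Type*} [Field K] {n : ℕ} (e c t : K) (a : Fin n → K) :
    C e * (C c + ∑ m, C (a m) * X m) - C t ∈ DDS2021.spsClass K n 1 1 := by
  refine ⟨fun _ _ o => o.elim (e * c - t) fun m => e * a m, ?_⟩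
  rw [Fin.sum_univ_one, Fin.prod_univ_one]
  simp only [Option.elim_none, Option.elim_some]
  rw [C_mul_affine_eq, C_sub]
  ring

/-- A constant is a `ΠΣ` circuit with one (constant) affine factor. -/
private theorem C_mem_spsClass_one_one {K : Type*} [Field K] {n : ℕ} (t : K) :
    (C t : MvPolynomial (Fin n) K) ∈ DDS2021.spsClass K n 1 1 := by
  refine ⟨fun _ _ o => o.elim t fun _ => 0, ?_⟩
  rw [Fin.sum_univ_one, Fin.prod_univ_one]
  simp

/-- `ΠΣ` is closed under finite products (iterating `DDS2021.mul_mem_spsClass_one`). -/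
private theorem prod_mem_spsClass_one {K : Type*} [Field K] {n D : ℕ} :
    ∀ (s : ℕ) (T : Fin s → MvPolynomial (Fin n) K),
      (∀ i, T i ∈ DDS2021.spsClass K n 1 D) → ∏ i, T i ∈ DDS2021.spsClass K n 1 (s * D) := by
  intro s
  induction s with
  | zero =>
    intro T _
    rw [Fin.prod_univ_zero, Nat.zero_mul]
    exact DDS2021.GenCircuit.one_mem_spsClass_one
  | succ s ih =>
    intro T hT
    rw [Fin.prod_univ_succ, add_one_mul, Nat.add_comm]
    exact DDS2021.mul_mem_spsClass_one (hT 0) (ih _ fun i => hT i.succ)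

/-- The sum of two `ΠΣ` circuits with `D` factors each is a `Σ^[2]Π^[D]Σ` circuit. -/
private theorem add_mem_spsClass_two {K : Type*} [Field K] {n D : ℕ} {f g : MvPolynomial (Fin n) K}
    (hf : f ∈ DDS2021.spsClass K n 1 D) (hg : g ∈ DDS2021.spsClass K n 1 D) :
    f + g ∈ DDS2021.spsClass K n 2 D := by
  obtain ⟨α, rfl⟩ := hf
  obtain ⟨β, rfl⟩ := hg
  refine ⟨![α 0, β 0], ?_⟩
  rw [Fin.sum_univ_one, Fin.sum_univ_one, Fin.sum_univ_two]
  simp only [Matrix.cons_val_zero, Matrix.cons_val_one]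

/-! ## Kumar's construction -/

/-- Roots: over an algebraically closed field, `Y^d + 1 = ∏_{k<d} (Y - η_k)` for some `η : Fin d → F`. -/
theorem exists_X_pow_add_one_eq_prod (F : Type*) [Field F] [IsAlgClosed F] {d : ℕ} (hd : 0 < d) :
    ∃ η : Fin d → F, (Polynomial.X ^ d + 1 : Polynomial F) = ∏ k, (Polynomial.X - Polynomial.C (η k)) := by
  -- a multiset of `d` roots, enumerated by `Fin d`
  have key : ∀ (e : ℕ) (S : Multiset F), Multiset.card S = e → ∃ η : Fin e → F,
      (S.map fun a => Polynomial.X - Polynomial.C a).prod =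
        ∏ k, (Polynomial.X - Polynomial.C (η k)) := by
    intro e
    induction e with
    | zero =>
      intro S hS
      refine ⟨fun k => k.elim0, ?_⟩
      rw [Multiset.card_eq_zero.mp hS, Multiset.map_zero, Multiset.prod_zero, Fin.prod_univ_zero]
    | succ e ih =>
      intro S hS
      obtain ⟨x, hx⟩ := Multiset.card_pos_iff_exists_mem.mp (by omega : 0 < Multiset.card S)
      obtain ⟨S', rfl⟩ := Multiset.exists_cons_of_mem hx
      rw [Multiset.card_cons] at hS
      obtain ⟨η, hη⟩ := ih S' (by omega)
      refine ⟨Matrix.vecCons x η, ?_⟩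
      rw [Multiset.map_cons, Multiset.prod_cons, hη, Fin.prod_univ_succ, Matrix.cons_val_zero]
      simp only [Matrix.cons_val_succ]
  have h1 : (Polynomial.X ^ d + 1 : Polynomial F) = Polynomial.X ^ d + Polynomial.C 1 := by
    rw [Polynomial.C_1]
  have hmonic : (Polynomial.X ^ d + 1 : Polynomial F).Monic := by
    rw [h1]
    exact Polynomial.monic_X_pow_add_C 1 hd.ne'
  have hdeg : (Polynomial.X ^ d + 1 : Polynomial F).natDegree = d := by
    rw [h1]
    exact Polynomial.natDegree_X_pow_add_C
  have hcard : Multiset.card (Polynomial.X ^ d + 1 : Polynomial F).roots = d := by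
    rw [IsAlgClosed.card_roots_eq_natDegree, hdeg]
  obtain ⟨η, hη⟩ := key d _ hcard
  refine ⟨η, ?_⟩
  rw [← hη, Polynomial.prod_multiset_X_sub_C_of_monic_of_roots_card_eq hmonic (hcard.trans hdeg.symm)]

/-- Expansion to first order: `∏ (1 + D·L_i) = 1 + D·G` with `φ G = ∑ φ L_i` whenever `φ D = 0`
(used with `D = ε^d`, `φ = (ε ↦ 0)`). -/
theorem exists_prod_one_add_mul_eq {A B : Type*} [CommRing A] [CommRing B] (φ : A →+* B)
    {s : ℕ} (D : A) (hD : φ D = 0) (L : Fin s → A) :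
    ∃ G : A, ∏ i, (1 + D * L i) = 1 + D * G ∧ φ G = ∑ i, φ (L i) := by
  induction s with
  | zero => exact ⟨0, by rw [Fin.prod_univ_zero, mul_zero, add_zero], by rw [map_zero, Fin.sum_univ_zero]⟩
  | succ s ih =>
    obtain ⟨G, hG, hφ⟩ := ih fun i => L i.succ
    have hG' : ∏ i : Fin s, (1 + D * L i.succ) = 1 + D * G := hG
    have hφ' : φ G = ∑ i : Fin s, φ (L i.succ) := hφ
    refine ⟨L 0 + G + D * L 0 * G, ?_, ?_⟩
    · rw [Fin.prod_univ_succ, hG']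
      ring
    · rw [Fin.sum_univ_succ, ← hφ', map_add, map_add, map_mul, map_mul, hD, zero_mul, zero_mul,
        add_zero]

/-- KEY (Kumar's construction in the DDS ε-currency): a sum of `s` `d`-th powers of affine forms,
`d ≥ 1`, lies in the border of `Σ^[2]Π^[s·d+1]Σ`. -/
theorem mem_border_spsClass_two_of_eq_sum_pow {F : Type*} [Field F] [IsAlgClosed F] {n d s : ℕ}
    (hd : 0 < d) (c : Fin s → F) (a : Fin s → Fin n → F) {f : MvPolynomial (Fin n) F}
    (hf : f = ∑ i, (C (c i) + ∑ m, C (a i m) * X m) ^ d) :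
    f ∈ DDS2021.border (DDS2021.spsClass (RatFunc F) n 2 (s * d + 1)) := by
  obtain ⟨η, hη⟩ := exists_X_pow_add_one_eq_prod F hd
  -- `ι : F[ε] → F(ε)` and `e = ε`
  obtain ⟨ι, hι⟩ : ∃ ι : Polynomial F →+* RatFunc F, ι = algebraMap (Polynomial F) (RatFunc F) :=
    ⟨_, rfl⟩
  obtain ⟨e, he⟩ : ∃ e : RatFunc F, e = ι Polynomial.X := ⟨_, rfl⟩
  have he0 : e ≠ 0 := by
    rw [he, hι]
    exact (map_ne_zero_iff _ (RatFunc.algebraMap_injective F)).mpr Polynomial.X_ne_zero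
  -- the affine forms read over `F[ε]` (`A`) and over `F(ε)` (`B`), and the powers `L i = A i ^ d`
  obtain ⟨A, hA⟩ : ∃ A : Fin s → MvPolynomial (Fin n) (Polynomial F),
      ∀ i, A i = C (Polynomial.C (c i)) + ∑ m, C (Polynomial.C (a i m)) * X m := ⟨_, fun _ => rfl⟩
  obtain ⟨B, hB⟩ : ∃ B : Fin s → MvPolynomial (Fin n) (RatFunc F),
      ∀ i, B i = C (ι (Polynomial.C (c i))) + ∑ m, C (ι (Polynomial.C (a i m))) * X m :=
    ⟨_, fun _ => rfl⟩
  obtain ⟨L, hL⟩ : ∃ L : Fin s → MvPolynomial (Fin n) (Polynomial F), ∀ i, L i = A i ^ d :=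
    ⟨_, fun _ => rfl⟩
  have hAB : ∀ i, map ι (A i) = B i := fun i => by rw [hA i, hB i, map_affine]
  have hA0 : ∀ i, map (Polynomial.constantCoeff : Polynomial F →+* F) (A i) =
      C (c i) + ∑ m, C (a i m) * X m := fun i => by
    rw [hA i, map_affine]
    simp only [Polynomial.constantCoeff_apply, Polynomial.coeff_C_zero]
  -- first-order expansion over `F[ε]`: `∏ (1 + ε^d A_i^d) = 1 + ε^d G`, `G(ε = 0) = f`
  have hEd : map (Polynomial.constantCoeff : Polynomial F →+* F)
      ((C Polynomial.X : MvPolynomial (Fin n) (Polynomial F)) ^ d) = 0 := by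
    rw [map_pow, map_C, Polynomial.constantCoeff_apply, Polynomial.coeff_X_zero, C_0, zero_pow hd.ne']
  obtain ⟨G, hG1, hG2⟩ :=
    exists_prod_one_add_mul_eq (map (Polynomial.constantCoeff : Polynomial F →+* F)) _ hEd L
  have hGf : map (Polynomial.constantCoeff : Polynomial F →+* F) G = f := by
    rw [hG2, hf]
    exact Finset.sum_congr rfl fun i _ => by rw [hL i, map_pow, hA0 i]
  -- Kumar's factors over `F(ε)`: `∏_k (ε B_i - η_k) = (ε B_i)^d + 1`, a `ΠΣ` circuit with `d` factors
  have hQ : ∀ i, (∏ k, (C e * B i - C (ι (Polynomial.C (η k))))) = (C e * B i) ^ d + 1 := by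
    intro i
    have h := congrArg (Polynomial.eval₂
      ((C : RatFunc F →+* MvPolynomial (Fin n) (RatFunc F)).comp (ι.comp Polynomial.C)) (C e * B i)) hη
    rw [Polynomial.eval₂_add, Polynomial.eval₂_X_pow, Polynomial.eval₂_one,
      Polynomial.eval₂_finsetProd] at h
    rw [h]
    exact Finset.prod_congr rfl fun k _ => by
      rw [Polynomial.eval₂_sub, Polynomial.eval₂_X, Polynomial.eval₂_C, RingHom.comp_apply,
        RingHom.comp_apply]
  have hQmem : ∀ i, (∏ k, (C e * B i - C (ι (Polynomial.C (η k))))) ∈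
      DDS2021.spsClass (RatFunc F) n 1 d := by
    intro i
    have h := prod_mem_spsClass_one d (fun k => C e * B i - C (ι (Polynomial.C (η k)))) fun k => by
      rw [hB i]
      exact C_mul_affine_sub_mem e _ _ _
    rwa [mul_one] at h
  have hP : (∏ i, ∏ k, (C e * B i - C (ι (Polynomial.C (η k))))) ∈
      DDS2021.spsClass (RatFunc F) n 1 (s * d) :=
    prod_mem_spsClass_one s _ hQmem
  -- the `Σ^[2]Π^[s·d+1]Σ` circuit `P·ε^{-d} + 1·(-ε^{-d})` over `F(ε)`
  obtain ⟨κ, hκ⟩ : ∃ κ : RatFunc F, κ = (e ^ d)⁻¹ := ⟨_, rfl⟩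
  have hκ1 : (C e : MvPolynomial (Fin n) (RatFunc F)) ^ d * C κ = 1 := by
    rw [hκ, ← C_pow, ← C_mul, mul_inv_cancel₀ (pow_ne_zero d he0), C_1]
  have h1 : (1 : MvPolynomial (Fin n) (RatFunc F)) ∈ DDS2021.spsClass (RatFunc F) n 1 (s * d) :=
    DDS2021.GenCircuit.one_mem_spsClass_one
  have hcirc : (∏ i, ∏ k, (C e * B i - C (ι (Polynomial.C (η k))))) * C κ + 1 * C (-κ) ∈
      DDS2021.spsClass (RatFunc F) n 2 (s * d + 1) :=
    add_mem_spsClass_two (DDS2021.mul_mem_spsClass_one hP (C_mem_spsClass_one_one κ))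
      (DDS2021.mul_mem_spsClass_one h1 (C_mem_spsClass_one_one (-κ)))
  -- `P = 1 + ε^d · (map ι G)`, hence the circuit computes `map ι G`, which approximates `f`
  have hPg : 1 + C e ^ d * map ι G = ∏ i, ∏ k, (C e * B i - C (ι (Polynomial.C (η k)))) := by
    have h := congrArg (map ι) hG1
    rw [map_add, map_one, map_mul, map_pow, map_C, ← he, map_prod] at h
    rw [← h]
    exact Finset.prod_congr rfl fun i _ => by
      rw [map_add, map_one, map_mul, map_pow, map_C, ← he, hL i, map_pow, hAB i, hQ i, mul_pow,
        add_comm]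
  have hfin : (∏ i, ∏ k, (C e * B i - C (ι (Polynomial.C (η k))))) * C κ + 1 * C (-κ) = map ι G := by
    rw [← hPg, C_neg]
    linear_combination (map ι G) * hκ1
  refine ⟨_, hcirc, ?_⟩
  rw [hfin]
  exact DDS2021.isEpsApprox_iff_exists_map.mpr ⟨G, by rw [hι], hGf⟩

/-- Homogeneous forms: `waringSums F n d s ⊆ border Σ^[2]Π^[s·d+1]Σ` (`d ≥ 1`). -/
theorem mem_border_spsClass_two_of_mem_waringSums {F : Type*} [Field F] [IsAlgClosed F]
    {n d s : ℕ} (hd : 0 < d) {f : MvPolynomial (Fin n) F} (hf : f ∈ waringSums F n d s) :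
    f ∈ DDS2021.border (DDS2021.spsClass (RatFunc F) n 2 (s * d + 1)) := by
  obtain ⟨a, rfl⟩ := hf
  refine mem_border_spsClass_two_of_eq_sum_pow hd (fun _ => 0) a ?_
  refine Finset.sum_congr rfl fun i _ => ?_
  show linearForm (a i) ^ d = (C 0 + ∑ m, C (a i m) * X m) ^ d
  rw [C_0, zero_add]
  rfl

/-- Padding in the top fan-in: `Σ^[k]Π^[D+1]Σ ⊆ Σ^[k']Π^[D+1]Σ` for `k ≤ k'` (extra products contain
the zero form). -/
theorem isSPS_mono_left {K : Type*} [Field K] {n k k' D : ℕ} (hk : k ≤ k')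
    {f : MvPolynomial (Fin n) K} (hf : MS2021.IsSPS k (D + 1) f) : MS2021.IsSPS k' (D + 1) f := by
  induction k', hk using Nat.le_induction with
  | base => exact hf
  | succ k' _ ih =>
    obtain ⟨α, hα⟩ := ih
    refine ⟨Matrix.vecCons 0 α, ?_⟩
    have h0 : (∏ j : Fin (D + 1), (C ((0 : Fin (D + 1) → Option (Fin n) → K) j none) +
        ∑ m : Fin n, C ((0 : Fin (D + 1) → Option (Fin n) → K) j (some m)) * X m) :
        MvPolynomial (Fin n) K) = 0 :=
      Finset.prod_eq_zero (Finset.mem_univ (0 : Fin (D + 1))) (by simp)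
    rw [Fin.sum_univ_succ, Matrix.cons_val_zero, h0, zero_add]
    simp only [Matrix.cons_val_succ]
    exact hα

/-- **UNIVERSALITY of border depth three with top fan-in `k ≥ 2`** (Kumar 2020; affine Waring
decomposition `mem_span_affinePowers` for non-homogeneous `f`): every polynomial over an
algebraically closed field of characteristic zero is in `border Σ^[k]Π^[D]Σ` for some `D`. -/
theorem exists_mem_border_spsClass {F : Type*} [Field F] [IsAlgClosed F] [CharZero F] {n : ℕ}
    (f : MvPolynomial (Fin n) F) {k : ℕ} (hk : 2 ≤ k) :
    ∃ D, f ∈ DDS2021.border (DDS2021.spsClass (RatFunc F) n k D) := by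
  obtain ⟨d, hd, hfd⟩ : ∃ d, 0 < d ∧ f.totalDegree ≤ d :=
    ⟨f.totalDegree + 1, Nat.succ_pos _, Nat.le_succ _⟩
  obtain ⟨r, w, g, hsum⟩ := Submodule.mem_span_set'.1 (mem_span_affinePowers f hfd)
  have hg : ∀ i, ∃ b : Fin (n + 1) → F,
      (∑ v, C (b v) * Matrix.vecCons (1 : MvPolynomial (Fin n) F) (fun i => X i) v) ^ d =
        (g i : MvPolynomial (Fin n) F) := fun i => (g i).2
  choose b hb using hg
  have hμ : ∀ i, ∃ μ : F, μ ^ d = w i := fun i => IsAlgClosed.exists_pow_nat_eq (w i) hd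
  choose μ hμ using hμ
  -- absorb the coefficients: `w_i • (b_i·(1,x))^d = (μ_i b_i · (1,x))^d`
  have hf : f = ∑ i, (C (μ i * b i 0) + ∑ m, C (μ i * b i m.succ) * X m) ^ d := by
    rw [← hsum]
    refine Finset.sum_congr rfl fun i _ => ?_
    rw [← hb i, smul_eq_C_mul, ← hμ i, C_pow, ← mul_pow]
    simp only [Fin.sum_univ_succ, Matrix.cons_val_zero, Matrix.cons_val_succ, mul_one]
    rw [C_mul_affine_eq]
  obtain ⟨g', hg', happ⟩ := mem_border_spsClass_two_of_eq_sum_pow hd _ _ hf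
  exact ⟨r * d + 1, g', isSPS_mono_left hk hg', happ⟩

/-! ## The permanent family and the tightness of item 23622 -/

/-- The permanent family, in the verbatim typing of item 23622, IS in the ε-border of `Σ^[k₀]Π^[d(n)]Σ`
for every constant `k₀ ≥ 2` and SOME (non-p-bounded) `d : ℕ → ℕ`. -/
theorem perPoly_mem_border_spsClass {k₀ : ℕ} (hk : 2 ≤ k₀) :
    ∃ d : ℕ → ℕ, ∀ n : ℕ, MvPolynomial.rename (finProdFinEquiv (m := n) (n := n)) (perPoly (Fin n) ℂ) ∈
      DDS2021.border (DDS2021.spsClass (RatFunc ℂ) (n * n) k₀ (d n)) := by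
  have h : ∀ n : ℕ, ∃ D, MvPolynomial.rename (finProdFinEquiv (m := n) (n := n)) (perPoly (Fin n) ℂ) ∈
      DDS2021.border (DDS2021.spsClass (RatFunc ℂ) (n * n) k₀ D) := fun n =>
    exists_mem_border_spsClass _ hk
  choose d hd using h
  exact ⟨d, hd⟩

/-- **TIGHTNESS of `PerNotInBorderConstFaninEps` (stmt-ValiantsHypothesis-23622, PROVED with the
conjunct `IsPBounded d`)**: the same statement with `IsPBounded d ∧` deleted is FALSE —
the conjunct IsPBounded d of item 23622 is LOAD-BEARING: with it the statement is TRUE for every k₀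
(p780459), without it FALSE for every k₀ ≥ 2 (this theorem, witness k₀ = 2). -/
theorem perNotInBorderConstFaninEps_false_without_pBounded :
    ¬ ∀ k₀ : ℕ, ¬ ∃ d : ℕ → ℕ, ∀ n : ℕ,
      MvPolynomial.rename (finProdFinEquiv (m := n) (n := n)) (perPoly (Fin n) ℂ) ∈
        DDS2021.border (DDS2021.spsClass (RatFunc ℂ) (n * n) k₀ (d n)) := by
  exact fun h => h 2 (perPoly_mem_border_spsClass le_rfl)

/-- Sanity: the item's statement, for reference (its proof `perNotInBorderConstFaninEps_holds` lives in
`Theorems/DecompCycle1CPerBorderConstDepth.lean`, not imported here). -/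
example : PerNotInBorderConstFaninEps =
    ∀ k₀ : ℕ, ¬ ∃ d : ℕ → ℕ, IsPBounded d ∧ ∀ n : ℕ,
      MvPolynomial.rename (finProdFinEquiv (m := n) (n := n)) (perPoly (Fin n) ℂ) ∈
        DDS2021.border (DDS2021.spsClass (RatFunc ℂ) (n * n) k₀ (d n)) := rfl

end Summit.ValiantsHypothesis.ValiantsHypothesis.Theorems.DecompCycle1CPerBorderTopFaninTwo
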